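import Literature.Computability.MetaComplexity.ConstructiveSeparations
import Literature.Computability.Complexity.CodeFPListKit
import HarnessLib

/-!
# Constructive separation of `NP ⊄ P`: discharge of `pConstructiveSeparation_of_not_NP_subset_P`

Sibling proof file of `ConstructiveSeparations.lean` (topic `Computability/MetaComplexity`). It proves
the named fact `pConstructiveSeparation_of_not_NP_subset_P` — Theorem 1.2 of Chen–Jin–Santhanam–Williams
[ChenEtAl2022] for the pair `(𝒞, 𝒟) = (P, NP)`, i.e. the theorem of Gutfreund–Shaltiel–Ta-Shma
[GutfreundShaltielTashma2007]: if `NP ⊄ P` then for every length-paddable `NP`-complete `L` and every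
`L'' ∈ P` there is a `P`-refuter printing, on `1ⁿ`, an `n`-bit string of `L ∆ L''` for infinitely
many `n` — as `theorem pConstructiveSeparation_of_not_NP_subset_P_holds`.

## The printed proof and the road taken

[ChenEtAl2022, §5] proves Thm. 1.2 through *constant-size list-refuters* (Def. 4: on `1ⁿ` print
`c = O(1)` strings, the `i`-th of length exactly `ℓ^{(i)}(n)` for a strictly increasing polynomial
`ℓ^{(i)} ≥ n`, one of which is a counterexample for infinitely many `n`), Lemma 6 (a constant-size
list-refuter yields a refuter: some slot `i` is hit infinitely often, and `1^{ℓ^{(i)}(n)} ↦ x_n^{(i)}`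
is a refuter), and, for `𝒟 = Σₖᵖ`, Thm. 5 ("adaptation of [GutfreundST07]"): a search-to-decision
reduction driven by the refuted algorithm `A` either finds a counterexample or exposes an
inconsistency of `A`'s answers on a constant number of queries, padded to a common length.
Thm. 5 drives the search with a *downward self-reducible* complete language `M` (`SAT`); for
`𝒟 = NP` we drive it, as in the original [GutfreundShaltielTashma2007], with the `NP`-witnesses of
`L` itself (`NP = ∃·P` is the tree's definition of `NP`), which needs no formalised `SAT`. All other
ingredients are the printed ones: the common padded query length `ℓ(n)` (§5.1), the bad input
lengths being infinite because `𝒟 ⊄ P` (§5.1), the inconsistency triple `y, y0, y1` of the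
search-to-decision reduction (Algorithm 1 / proof of Thm. 4), Lemma 6.

## Architecture (namespace `GSTRefuter`)

* **Engine** (`stepB`, `searchZ`, `failIdx`, `failPrefix`, `probes`, `searchZ_sound`): the prefix
  search driven by an oracle bit `B`, its five probe prefixes (root, found string, inconsistency
  triple), and its soundness: if `B` agrees on the probes with a prefix-extensible property `Q`
  holding at the root, the found string has `Q`. Polynomial time on codes (`codeFP_searchZ`, …) by
  the typed `FP` algebra of `CodeFP.lean` (one `foldl`, one `findIdx`).
* **Data** (`Setting`, `Setting.Spec`, `Setting.Codes`): `L`, its padding, the refuted bit `A`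
  (indicator of `L'' ∈ P`), a verifier bit `Vb` with witness polynomial `p`.
* **Level 1** (`good₁`, `H₁ ∈ NP`, `g₁`, `B₁`, `searchFails`): the witness search for `y` through the
  `NP` language `H₁ = {⟨y, z⟩ : some u ∈ {0,1}^{p|y|} extending z carries a witness of y}`, reduced to
  `L` (`Red`, a Karp reduction with its output-length polynomial) and padded to length `ℓ₁ |y|`.
* **Level 2** (`bad₂`, `H₂ ∈ NP`, `g₂`, `B₂`, `y₂`): the search for a *detectably bad* input of
  length `n` (`A y ∧ searchFails y`, or `¬A y ∧ y ∈ L`), through `H₂`, padded to length `ℓ₂ n`.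
* **List-refuter** (`slots`, eleven strings; `exists_mem_slots_not_agree`): if `A` errs on some
  input of length `n` it errs on a slot. `frequently_exists_not_agree`: `L ∉ P` gives infinitely
  many such `n` (patch finitely many lengths by a table). Pigeonhole
  (`exists_frequently_of_frequently_exists_lt`), Lemma 6 (`slotRefuter`, `isPRefuter_slotRefuter`).

## References

* L. Chen, C. Jin, R. Santhanam, R. Williams, *Constructive separations and their consequences*,
  FOCS 2021 / TheoretiCS 2024, arXiv:2203.14379v5: Def. 4, Lemma 6, Thm. 4 (§5.1), Thm. 5 (§5.2).
* D. Gutfreund, R. Shaltiel, A. Ta-Shma, *If NP languages are hard on the worst-case, then it is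
  easy to find their hard instances*, Comput. Complexity 16 (2007).
* S. Arora, B. Barak, *Computational Complexity: A Modern Approach*, CUP 2009, §1.3, Def. 2.1, 2.7.
-/

namespace Literature.Computability.MetaComplexity

open _root_.Computability Complexity Filter Polynomial Brick CodeFP

namespace GSTRefuter

/-! ### The prefix-search engine (combinatorics) -/

section Engine

variable (B : List Bool → Bool)

/-- One round of the search-to-decision prefix extension driven by the oracle bit `B`: extend `z`
by `0` if `B` claims the extension `z0` still has a good completion, else by `1`. [folklore] -/
def stepB (z : List Bool) : List Bool :=
  z ++ [!B (z ++ [false])]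

/-- The string found after `m` rounds of prefix extension from the empty prefix. [folklore] -/
def searchZ (m : ℕ) : List Bool :=
  (stepB B)^[m] []

/-- Each round appends one bit. [folklore] -/
theorem length_iterate_stepB (k : ℕ) : ((stepB B)^[k] []).length = k := by
  induction k with
  | zero => rfl
  | succ k ih => rw [Function.iterate_succ_apply', stepB, List.length_append, ih]; rfl

/-- `|searchZ B m| = m`. [folklore] -/
@[simp] theorem length_searchZ (m : ℕ) : (searchZ B m).length = m :=
  length_iterate_stepB B m

/-- The rounds are the prefixes of the final string. [folklore] -/
theorem take_iterate_stepB {i k : ℕ} (h : i ≤ k) : ((stepB B)^[k] []).take i = (stepB B)^[i] [] := by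
  induction k with
  | zero =>
    obtain rfl : i = 0 := Nat.le_zero.mp h
    rfl
  | succ k ih =>
    rcases Nat.lt_or_eq_of_le h with hlt | rfl
    · rw [Function.iterate_succ_apply', stepB, List.take_append_of_le_length
        (by rw [length_iterate_stepB]; omega)]
      exact ih (by omega)
    · exact List.take_of_length_le (by rw [length_iterate_stepB])

/-- Prefixes of the found string are the intermediate rounds. [folklore] -/
theorem take_searchZ {i m : ℕ} (h : i ≤ m) : (searchZ B m).take i = (stepB B)^[i] [] :=
  take_iterate_stepB B h

/-- The next prefix is one round applied to the previous one. [folklore] -/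
theorem take_succ_searchZ {i m : ℕ} (h : i < m) :
    (searchZ B m).take (i + 1) = stepB B ((searchZ B m).take i) := by
  rw [take_searchZ B h, take_searchZ B h.le, Function.iterate_succ_apply']

/-- The index of the first round at which the oracle's answers become inconsistent along the found
string (`m` if there is none): `B` holds on the prefix of length `i` but not on that of length
`i + 1`. [folklore] -/
def failIdx (m : ℕ) : ℕ :=
  (List.range m).findIdx fun i => B ((searchZ B m).take i) && !B ((searchZ B m).take (i + 1))

/-- The prefix at the first inconsistency. [folklore] -/
def failPrefix (m : ℕ) : List Bool :=
  (searchZ B m).take (failIdx B m)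

/-- The five probe prefixes of one search: the root, the found string, and the inconsistency
triple. [folklore] -/
def probes (m : ℕ) : List (List Bool) :=
  [[], searchZ B m, failPrefix B m, failPrefix B m ++ [false], failPrefix B m ++ [true]]

/-- `failIdx B m ≤ m`. [folklore] -/
theorem failIdx_le (m : ℕ) : failIdx B m ≤ m := by
  have h := List.findIdx_le_length
    (p := fun i => B ((searchZ B m).take i) && !B ((searchZ B m).take (i + 1))) (xs := List.range m)
  rwa [List.length_range] at h

/-- `|failPrefix B m| = failIdx B m`. [folklore] -/
theorem length_failPrefix (m : ℕ) : (failPrefix B m).length = failIdx B m := by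
  rw [failPrefix, List.length_take, length_searchZ, min_eq_left (failIdx_le B m)]

/-- Every probe has length at most `m + 1`. [folklore] -/
theorem length_le_of_mem_probes {m : ℕ} {z : List Bool} (h : z ∈ probes B m) : z.length ≤ m + 1 := by
  have h1 := length_failPrefix B m
  have h2 := failIdx_le B m
  simp only [probes, List.mem_cons, List.not_mem_nil, or_false] at h
  rcases h with rfl | rfl | rfl | rfl | rfl <;> simp <;> omega

/-- **The inconsistency triple.** If the oracle accepts the root but rejects the found string,
then at the first drop the oracle accepts a prefix and rejects both of its one-bit extensions.
[folklore] -/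
theorem failPrefix_spec {m : ℕ} (h0 : B [] = true) (hm : B (searchZ B m) = false) :
    failIdx B m < m ∧ B (failPrefix B m) = true ∧ B (failPrefix B m ++ [false]) = false ∧
      B (failPrefix B m ++ [true]) = false := by
  set z := searchZ B m with hz
  set P : ℕ → Bool := fun i => B (z.take i) && !B (z.take (i + 1)) with hP
  -- a drop exists
  have hex : ∃ i, i < m ∧ B (z.take i) = true ∧ B (z.take (i + 1)) = false := by
    classical
    have hmS : ∃ i, B (z.take i) = false := ⟨m, by rwa [List.take_of_length_le (by rw [hz, length_searchZ])]⟩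
    let i₀ := Nat.find hmS
    have hi₀ : B (z.take i₀) = false := Nat.find_spec hmS
    have hne : i₀ ≠ 0 := by
      intro h
      rw [h, List.take_zero] at hi₀
      rw [hi₀] at h0
      exact Bool.false_ne_true h0
    obtain ⟨j, hj⟩ := Nat.exists_eq_succ_of_ne_zero hne
    have hjlt : j < i₀ := by omega
    have hjt : B (z.take j) = true := by
      have := Nat.find_min hmS hjlt
      simpa using this
    have hj1 : B (z.take (j + 1)) = false := by
      have : j + 1 = i₀ := by omega
      rw [this]; exact hi₀
    refine ⟨j, ?_, hjt, hj1⟩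
    by_contra hjm
    rw [List.take_of_length_le (by rw [hz, length_searchZ]; exact not_lt.mp hjm)] at hjt
    rw [hjt] at hm
    exact Bool.false_ne_true hm.symm
  obtain ⟨i, him, hi1, hi2⟩ := hex
  have hexP : ∃ x ∈ List.range m, P x = true := ⟨i, List.mem_range.2 him, by simp [hP, hi1, hi2]⟩
  have hlt : failIdx B m < m := by
    have := List.findIdx_lt_length_of_exists hexP
    rwa [List.length_range] at this
  have hPk : P (failIdx B m) = true := by
    have h := List.findIdx_getElem (p := P) (xs := List.range m) (w := by rwa [List.length_range])
    rwa [List.getElem_range] at h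
  simp only [hP, Bool.and_eq_true, Bool.not_eq_eq_eq_not, Bool.not_true] at hPk
  obtain ⟨hk1, hk2⟩ := hPk
  rw [take_succ_searchZ B hlt, stepB] at hk2
  set t := failPrefix B m with ht
  change B t = true at hk1
  change B (t ++ [!B (t ++ [false])]) = false at hk2
  refine ⟨hlt, hk1, ?_⟩
  cases h : B (t ++ [false])
  · rw [h] at hk2
    exact ⟨rfl, hk2⟩
  · rw [h, Bool.not_true, h] at hk2
    exact absurd hk2 (by decide)

/-- A proper prefix of a string of length `m` extends by one bit inside it. [folklore] -/
theorem prefix_append_bit_of_lt {z y : List Bool} (hzy : z <+: y) (hlt : z.length < y.length) :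
    ∃ b : Bool, z ++ [b] <+: y := by
  have h1 : z = y.take z.length := List.prefix_iff_eq_take.1 hzy
  obtain ⟨c, rest, hcr⟩ : ∃ c rest, y.drop z.length = c :: rest := by
    cases h : y.drop z.length with
    | nil => have := congrArg List.length h; simp at this; omega
    | cons c rest => exact ⟨c, rest, rfl⟩
  refine ⟨c, rest, ?_⟩
  calc z ++ [c] ++ rest = z ++ (c :: rest) := by simp
    _ = y.take z.length ++ y.drop z.length := by rw [← h1, hcr]
    _ = y := List.take_append_drop _ _

/-- **Soundness of the search.** If `Q` passes from every short prefix to one of its one-bit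
extensions, the oracle agrees with `Q` on the five probes, and the root satisfies `Q`, then the
found string satisfies `Q`. [folklore] -/
theorem searchZ_sound {m : ℕ} {Q : List Bool → Prop}
    (hQ : ∀ z, Q z → z.length < m → Q (z ++ [false]) ∨ Q (z ++ [true]))
    (hagree : ∀ z ∈ probes B m, (B z = true ↔ Q z)) (h0 : Q []) : Q (searchZ B m) := by
  have hp : ∀ z, z ∈ probes B m ↔ z = [] ∨ z = searchZ B m ∨ z = failPrefix B m ∨
      z = failPrefix B m ++ [false] ∨ z = failPrefix B m ++ [true] := fun z => by simp [probes]
  have hB0 : B [] = true := (hagree [] ((hp _).2 (Or.inl rfl))).2 h0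
  cases hzm : B (searchZ B m)
  · obtain ⟨hlt, h1, h2, h3⟩ := failPrefix_spec B hB0 hzm
    have hQt : Q (failPrefix B m) := (hagree _ ((hp _).2 (Or.inr (Or.inr (Or.inl rfl))))).1 h1
    have hlen : (failPrefix B m).length < m := by rw [length_failPrefix]; exact hlt
    rcases hQ _ hQt hlen with h | h
    · have := (hagree _ ((hp _).2 (Or.inr (Or.inr (Or.inr (Or.inl rfl)))))).2 h
      rw [h2] at this; exact absurd this Bool.false_ne_true
    · have := (hagree _ ((hp _).2 (Or.inr (Or.inr (Or.inr (Or.inr rfl)))))).2 h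
      rw [h3] at this; exact absurd this Bool.false_ne_true
  · exact (hagree _ ((hp _).2 (Or.inr (Or.inl rfl)))).1 hzm

end Engine

/-! ### The prefix-search engine is polynomial time -/

section EngineFP

variable {σ : Type} {eσ : σ → List Bool} {Bf : σ → List Bool → Bool} {m : σ → ℕ}

/-- One round of the search is computed on codes (given the oracle bit on codes).
[cite: AroraBarak2009, §1.3 (composition of polynomial-time functions)] -/
theorem codeFP_stepB (hB : CodeFP (pairE eσ strE) bitE fun q => Bf q.1 q.2) :
    CodeFP (pairE eσ strE) strE fun q => stepB (Bf q.1) q.2 := by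
  have z0 : CodeFP (pairE eσ strE) strE (fun q => q.2 ++ [false]) :=
    strAppend.comp ((snd _ _).pair (const _ [false]))
  have b : CodeFP (pairE eσ strE) bitE (fun q => !Bf q.1 (q.2 ++ [false])) :=
    (hB.comp ((fst _ _).pair z0)).not
  have bs : CodeFP (pairE eσ strE) strE (fun q => [!Bf q.1 (q.2 ++ [false])]) := b.recodeOut fun _ => rfl
  exact (strAppend.comp ((snd _ _).pair bs)).congr fun _ => rfl

/-- **The search is polynomial time** (a fold of `m s` rounds, the prefix growing by one bit per
round). [cite: AroraBarak2009, §1.3 (polynomially bounded loops)] -/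
theorem codeFP_searchZ (hB : CodeFP (pairE eσ strE) bitE fun q => Bf q.1 q.2) (hm : CodeFP eσ unE m) :
    CodeFP eσ strE fun s => searchZ (Bf s) (m s) := by
  have hstep : CodeFP (pairE eσ (pairE unitE strE)) strE (fun t => stepB (Bf t.1) t.2.2) :=
    (codeFP_stepB hB).comp ((fst _ _).pair (snd _ _).snd')
  have hfold := foldl (σ := σ) (eσ := eσ) (α := Unit) (eα := unitE) (eβ := strE)
    (step := fun s _ z => stepB (Bf s) z) (init := fun _ => ([] : List Bool)) hstep (const eσ []) X
    (fun s l₁ l₂ => by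
      rw [foldl_units_eq_iterate', eval_X, pairE_apply, length_boolPair]
      have h1 : ((stepB (Bf s))^[l₁.length] []).length = l₁.length := length_iterate_stepB _ _
      have h2 := length_le_length_rawE unitE (l₁ ++ l₂)
      rw [List.length_append] at h2
      change ((stepB (Bf s))^[l₁.length] []).length ≤ _
      dsimp only
      omega)
  refine (hfold.comp ((CodeFP.id eσ).pair (replicateUnit.comp hm))).congr fun s => ?_
  change (List.replicate (m s) ()).foldl (fun z _ => stepB (Bf s) z) [] = searchZ (Bf s) (m s)
  rw [foldl_units_eq_iterate]; rfl

/-- The drop test at index `i` along a string `z`, with the index capped by `|z|` (harmless: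
`take` ignores the excess). [folklore] -/
theorem codeFP_dropTest (hB : CodeFP (pairE eσ strE) bitE fun q => Bf q.1 q.2) :
    CodeFP (pairE (pairE eσ strE) natE) bitE
      fun t => Bf t.1.1 (t.1.2.take t.2) && !Bf t.1.1 (t.1.2.take (t.2 + 1)) := by
  have s' : CodeFP (pairE (pairE eσ strE) natE) eσ (fun t => t.1.1) := (fst _ _).fst'
  have z' : CodeFP (pairE (pairE eσ strE) natE) strE (fun t => t.1.2) := (fst _ _).snd'
  have i' : CodeFP (pairE (pairE eσ strE) natE) natE (fun t => t.2) := snd _ _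
  have len : CodeFP (pairE (pairE eσ strE) natE) unE (fun t => t.1.2.length) := strLength.comp z'
  have iu : CodeFP (pairE (pairE eσ strE) natE) unE (fun t => min t.2 t.1.2.length) :=
    unOfNatMin.comp (len.pair i')
  have i1 : CodeFP (pairE (pairE eσ strE) natE) natE (fun t => t.2 + 1) := natAdd.comp (i'.pair (const _ 1))
  have iu1 : CodeFP (pairE (pairE eσ strE) natE) unE (fun t => min (t.2 + 1) t.1.2.length) :=
    unOfNatMin.comp (len.pair i1)
  have t1 : CodeFP (pairE (pairE eσ strE) natE) strE (fun t => t.1.2.take (min t.2 t.1.2.length)) :=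
    strTake.comp (iu.pair z')
  have t2 : CodeFP (pairE (pairE eσ strE) natE) strE (fun t => t.1.2.take (min (t.2 + 1) t.1.2.length)) :=
    strTake.comp (iu1.pair z')
  have b1 : CodeFP (pairE (pairE eσ strE) natE) bitE (fun t => Bf t.1.1 (t.1.2.take (min t.2 t.1.2.length))) :=
    hB.comp (s'.pair t1)
  have b2 : CodeFP (pairE (pairE eσ strE) natE) bitE
      (fun t => Bf t.1.1 (t.1.2.take (min (t.2 + 1) t.1.2.length))) := hB.comp (s'.pair t2)
  have tml : ∀ (l : List Bool) (i : ℕ), l.take (min i l.length) = l.take i := fun l i =>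
    List.take_eq_take_iff.2 (by rw [Nat.min_assoc, Nat.min_self])
  exact (b1.and b2.not).congr fun t => by simp only [tml]

/-- **The index of the first inconsistency is polynomial time.** [cite: AroraBarak2009, §1.3] -/
theorem codeFP_failIdx (hB : CodeFP (pairE eσ strE) bitE fun q => Bf q.1 q.2) (hm : CodeFP eσ unE m) :
    CodeFP eσ natE fun s => failIdx (Bf s) (m s) := by
  have h := (findIdxFP (codeFP_dropTest hB)).comp
    (((CodeFP.id eσ).pair (codeFP_searchZ hB hm)).pair (urange.comp hm))
  exact h.congr fun s => rfl

/-- **The prefix at the first inconsistency is polynomial time.** [cite: AroraBarak2009, §1.3] -/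
theorem codeFP_failPrefix (hB : CodeFP (pairE eσ strE) bitE fun q => Bf q.1 q.2) (hm : CodeFP eσ unE m) :
    CodeFP eσ strE fun s => failPrefix (Bf s) (m s) := by
  have hz := codeFP_searchZ hB hm
  have hi : CodeFP eσ unE (fun s => min (failIdx (Bf s) (m s)) (searchZ (Bf s) (m s)).length) :=
    unOfNatMin.comp ((strLength.comp hz).pair (codeFP_failIdx hB hm))
  exact (strTake.comp (hi.pair hz)).congr fun s => by
    change (searchZ (Bf s) (m s)).take (min (failIdx (Bf s) (m s)) (searchZ (Bf s) (m s)).length) = _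
    rw [show (searchZ (Bf s) (m s)).take (min (failIdx (Bf s) (m s)) (searchZ (Bf s) (m s)).length) =
        (searchZ (Bf s) (m s)).take (failIdx (Bf s) (m s)) from
      List.take_eq_take_iff.2 (by rw [Nat.min_assoc, Nat.min_self])]
    rfl

/-- **The list of the five probes is polynomial time.** [cite: AroraBarak2009, §1.3] -/
theorem codeFP_probes (hB : CodeFP (pairE eσ strE) bitE fun q => Bf q.1 q.2) (hm : CodeFP eσ unE m) :
    CodeFP eσ (rawE strE) fun s => probes (Bf s) (m s) := by
  have hz := codeFP_searchZ hB hm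
  have ht := codeFP_failPrefix hB hm
  have ht0 : CodeFP eσ strE (fun s => failPrefix (Bf s) (m s) ++ [false]) :=
    strAppend.comp (ht.pair (const _ [false]))
  have ht1 : CodeFP eσ strE (fun s => failPrefix (Bf s) (m s) ++ [true]) :=
    strAppend.comp (ht.pair (const _ [true]))
  have c : ∀ {g : σ → List Bool} {k : σ → List (List Bool)}, CodeFP eσ strE g → CodeFP eσ (rawE strE) k →
      CodeFP eσ (rawE strE) (fun s => g s :: k s) := fun hg hk => (rawCons strE).comp (hg.pair hk)
  exact (c (const eσ ([] : List Bool)) (c hz (c ht (c ht0 (c ht1 (const eσ ([] : List (List Bool)))))))).congr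
    fun s => rfl

end EngineFP

/-! ### Plumbing: `P`-languages and `NP`-languages from programs on codes -/

section Plumbing

/-- A language whose Boolean membership test is computed on codes is in `P`.
[cite: AroraBarak2009, Def. 1.13] -/
theorem memP_of_codeFP {c : List Bool → Bool} (hc : CodeFP strE bitE c) :
    ({w | c w = true} : Language Bool) ∈ Classes.P := by
  obtain ⟨g, hg, hgc⟩ := hc
  refine mem_P_of_mem_FP hg _ fun w => ⟨fun h => ?_, fun h => ?_⟩
  · have h' : c w = true := h
    rw [show g w = bitE (c w) from hgc w, h']; rfl
  · have h' : c w = false := by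
      have h'' : ¬ c w = true := h
      simpa using h''
    rw [show g w = bitE (c w) from hgc w, h']; rfl

/-- A language with a polynomially bounded certificate tested by a program on codes is in `NP`.
[cite: AroraBarak2009, Def. 2.1] -/
theorem memNP_of_codeFP {H : Language Bool} {chk : List Bool → Bool} (q : Polynomial ℕ)
    (hc : CodeFP strE bitE chk)
    (h : ∀ x, x ∈ H ↔ ∃ u : List Bool, u.length ≤ q.eval x.length ∧ chk (boolPair x u) = true) :
    H ∈ Nondeterministic.NP :=
  ⟨{w | chk w = true}, memP_of_codeFP hc, q, fun x => (h x).trans Iff.rfl⟩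

/-- **A length-padding map is computed on codes.** The machine of
`PolyTimeComputable (⟨x, 1ᵐ⟩ ↦ …) id pad` is only specified on genuine codes `⟨x, 1ᵐ⟩`; precomposing
it with the polynomial-time sanitiser `w ↦ ⟨fstF w, 1^{|sndF w|}⟩` (a genuine code, equal to `w` when
`w` is one) gives a total `FP` function agreeing with `pad` on codes. [cite: AroraBarak2009, §1.3] -/
theorem codeFP_pad {pad : List Bool × ℕ → List Bool}
    (h : PolyTimeComputable (fun p : List Bool × ℕ => boolPair p.1 (unaryEncodeNat p.2))
      (id : List Bool → List Bool) pad) :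
    CodeFP (pairE strE unE) strE pad := by
  -- the sanitiser, as a map `List Bool → List Bool × ℕ` computed from `id`-codes to pair codes
  have hsan : CodeFP strE (pairE strE unE) (fun w => (fstF w, (sndF w).length)) :=
    (of_fn fstF fstF_mem_FP fun _ => rfl).pair (strLength.comp (of_fn sndF sndF_mem_FP fun _ => rfl))
  obtain ⟨S, ⟨p₁, M₁, hM₁⟩, hS⟩ := hsan
  have hsan' : PolyTimeComputable (id : List Bool → List Bool)
      (fun p : List Bool × ℕ => boolPair p.1 (unaryEncodeNat p.2)) (fun w => (fstF w, (sndF w).length)) := by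
    refine ⟨p₁, M₁, fun w => ?_⟩
    have h₁ := hM₁ w
    rwa [show (id (S w) : List Bool) = boolPair (fstF w) (unaryEncodeNat (sndF w).length) from hS w] at h₁
  have hcomp := PolyTimeComputable.comp_holds h hsan'
  obtain ⟨p, M, hM⟩ := hcomp
  refine ⟨fun w => pad (fstF w, (sndF w).length), ⟨p, M, fun w => hM w⟩, fun q => ?_⟩
  obtain ⟨x, n⟩ := q
  simp [pairE_apply]

/-- **A Karp reduction with an output-length polynomial** (the data a refuter reads off a reduction
`H ≤ₚ L`: the `FP` function, a polynomial bounding its output length, and correctness). [cite: AroraBarak2009, Def. 2.7] -/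
structure Red (H L : Language Bool) where
  /-- the reduction -/
  r : List Bool → List Bool
  /-- a bound on its output length -/
  P : Polynomial ℕ
  /-- the reduction is polynomial time -/
  mem_FP : r ∈ FP
  /-- the output-length bound -/
  length_le : ∀ w, (r w).length ≤ P.eval w.length
  /-- correctness -/
  reduces : ∀ w, w ∈ H ↔ r w ∈ L

/-- Every Karp reduction carries an output-length polynomial (`exists_poly_length_le_of_mem_FP`).
[cite: AroraBarak2009, Def. 2.7 and §1.3] -/
theorem Red.nonempty_of_karpReducible {H L : Language Bool} (h : PolyTimeKarpReducible H L) :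
    Nonempty (Red H L) := by
  obtain ⟨r, hr, hrL⟩ := h
  obtain ⟨P, hP⟩ := exists_poly_length_le_of_mem_FP hr
  exact ⟨⟨r, P, hr, hP, hrL⟩⟩

/-- A reduction is computed on codes. [folklore] -/
theorem Red.codeFP {H L : Language Bool} (R : Red H L) : CodeFP strE strE R.r :=
  of_fn R.r R.mem_FP fun _ => rfl

/-- Evaluation of `X + C` is strictly increasing and dominates the identity. [folklore] -/
theorem strictMono_eval_X_add (C : Polynomial ℕ) : StrictMono fun n => (X + C).eval n := by
  intro a b hab
  simp only [eval_add, eval_X]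
  have := TM2Iter.eval_mono C hab.le
  omega

/-- `n ≤ (X + C)(n)`. [folklore] -/
theorem le_eval_X_add (C : Polynomial ℕ) (n : ℕ) : n ≤ (X + C).eval n := by
  simp [eval_add, eval_X]

/-- Unary evaluation of an `ℕ`-polynomial is computed on codes (`Brick.Plumb.polyFn`). [cite: AroraBarak2009, §1.3] -/
theorem codeFP_unPoly (Q : Polynomial ℕ) : CodeFP unE unE fun n => Q.eval n :=
  of_fn (Plumb.polyFn Q) (Plumb.polyFn_mem_FP Q) fun n => by
    rw [Plumb.polyFn_apply, length_unE, unE_eq_ones]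

/-- The prefix test is computed on codes. [folklore] -/
theorem codeFP_isPrefix : CodeFP (pairE strE strE) bitE fun q => decide (q.1 <+: q.2) := by
  have ht : CodeFP (pairE strE strE) strE (fun q => q.2.take q.1.length) :=
    strTake.comp ((strLength.comp (fst _ _)).pair (snd _ _))
  have he : CodeFP (pairE strE strE) bitE (fun q => decide (q.1 = q.2.take q.1.length)) :=
    (CodeFP.eq (eα := strE) Function.injective_id).comp ((fst _ _).pair ht)
  exact he.congr fun q => by
    by_cases hq : q.1 <+: q.2
    · rw [decide_eq_true hq, decide_eq_true (List.prefix_iff_eq_take.1 hq)]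
    · rw [decide_eq_false hq, decide_eq_false (fun h' => hq (List.prefix_iff_eq_take.2 h'))]

end Plumbing

/-! ### The data of the construction -/

/-- **The data a refuter is built from**: the target language `L`, its length padding `pad`
(`IsLengthPaddable`), the refuted polynomial-time algorithm `A` — a total Boolean function, the
indicator of the language `L'' ∈ P` it decides — and a polynomial-time verifier bit `Vb` for `L`
with witness-length polynomial `p` (`NP = ∃·P`). [cite: ChenEtAl2022, §5.2 (proof of Thm. 5)] -/
structure Setting where
  /-- the paddable `NP`-complete language -/
  L : Language Bool
  /-- its length padding -/
  pad : List Bool × ℕ → List Bool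
  /-- the refuted algorithm -/
  A : List Bool → Bool
  /-- the verifier bit of `L` -/
  Vb : List Bool → Bool
  /-- the witness-length polynomial -/
  p : Polynomial ℕ

namespace Setting

variable (S : Setting)

/-- **Correctness of the data**: `pad` pads to the exact target length preserving membership,
and `Vb`/`p` verify `L`. [cite: ChenEtAl2022, §5.2 (proof of Thm. 5)] -/
structure Spec : Prop where
  /-- padding reaches the target length -/
  pad_length : ∀ (x : List Bool) (m : ℕ), x.length ≤ m → (S.pad (x, m)).length = m
  /-- padding preserves membership -/
  pad_mem : ∀ (x : List Bool) (m : ℕ), x.length ≤ m → (S.pad (x, m) ∈ S.L ↔ x ∈ S.L)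
  /-- `Vb` is a verifier for `L` with witness length `p` -/
  ver : ∀ x : List Bool, x ∈ S.L ↔ ∃ w : List Bool, w.length ≤ S.p.eval x.length ∧ S.Vb (boolPair x w) = true

/-- **The data is polynomial time** (on codes). [cite: ChenEtAl2022, §5.2 (proof of Thm. 5)] -/
structure Codes : Prop where
  /-- the padding -/
  pad : CodeFP (pairE strE unE) strE S.pad
  /-- the refuted algorithm -/
  A : CodeFP strE bitE S.A
  /-- the verifier -/
  Vb : CodeFP strE bitE S.Vb

/-! ### Level 1: the witness search (search-to-decision for `L` through an `NP`-complete query language) -/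

/-- The all-prefix witness test: some prefix of `u` is a `Vb`-certificate of `y`. A certificate of
length `≤ p |y|` is thus presented by any string of length exactly `p |y|` extending it. [folklore] -/
def good₁ (y u : List Bool) : Bool :=
  (List.range (u.length + 1)).any fun k => S.Vb (boolPair y (u.take k))

/-- Unfolding of the all-prefix witness test. [folklore] -/
theorem good₁_eq_true_iff (y u : List Bool) :
    S.good₁ y u = true ↔ ∃ k, k ≤ u.length ∧ S.Vb (boolPair y (u.take k)) = true := by
  simp [good₁, List.any_eq_true]

/-- A good string certifies membership. [folklore] -/
theorem mem_of_good₁ (hS : S.Spec) {y u : List Bool} (hu : u.length ≤ S.p.eval y.length)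
    (h : S.good₁ y u = true) : y ∈ S.L := by
  obtain ⟨k, hk, hkV⟩ := (S.good₁_eq_true_iff y u).1 h
  exact (hS.ver y).2 ⟨u.take k, le_trans (by rw [List.length_take]; exact min_le_right _ _) hu, hkV⟩

/-- A member has a good string of length exactly `p |y|` (pad a certificate by zeros). [folklore] -/
theorem exists_good₁_of_mem (hS : S.Spec) {y : List Bool} (h : y ∈ S.L) :
    ∃ u : List Bool, u.length = S.p.eval y.length ∧ S.good₁ y u = true := by
  obtain ⟨w, hw, hwV⟩ := (hS.ver y).1 h
  refine ⟨w ++ List.replicate (S.p.eval y.length - w.length) false, by simp; omega, ?_⟩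
  exact (S.good₁_eq_true_iff _ _).2 ⟨w.length, by simp, by simpa using hwV⟩

/-- **The witness-prefix language** `H₁ = {⟨y, z⟩ : some u ∈ {0,1}^{p|y|} extending z is good for y}`
(an `NP` language: the question the search-to-decision reduction asks about the prefix `z`).
[cite: ChenEtAl2022, §5.2 (proof of Thm. 5, search-to-decision reduction using A)] -/
def H₁ : Language Bool :=
  {w | ∃ u : List Bool, u.length = S.p.eval (fstF w).length ∧ sndF w <+: u ∧ S.good₁ (fstF w) u = true}

/-- Membership of a pair in `H₁`. [folklore] -/
theorem boolPair_mem_H₁ (y z : List Bool) :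
    boolPair y z ∈ S.H₁ ↔ ∃ u : List Bool, u.length = S.p.eval y.length ∧ z <+: u ∧ S.good₁ y u = true := by
  change (∃ u : List Bool, u.length = S.p.eval (fstF (boolPair y z)).length ∧ sndF (boolPair y z) <+: u ∧
    S.good₁ (fstF (boolPair y z)) u = true) ↔ _
  rw [fstF_boolPair, sndF_boolPair]

/-- The certificate test of `H₁`: on `⟨⟨y, z⟩, u⟩`, `|u| = p |y|`, `z ⊑ u` and `u` is good. [folklore] -/
def chk₁ (w : List Bool) : Bool :=
  decide ((sndF w).length = S.p.eval (fstF (fstF w)).length) && decide (sndF (fstF w) <+: sndF w) &&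
    S.good₁ (fstF (fstF w)) (sndF w)

/-- The all-prefix witness test is polynomial time. [cite: AroraBarak2009, §1.3] -/
theorem codeFP_good₁ (hV : CodeFP strE bitE S.Vb) : CodeFP (pairE strE strE) bitE fun q => S.good₁ q.1 q.2 := by
  have y' : CodeFP (pairE (pairE strE strE) natE) strE (fun t => t.1.1) := (fst _ _).fst'
  have u' : CodeFP (pairE (pairE strE strE) natE) strE (fun t => t.1.2) := (fst _ _).snd'
  have k' : CodeFP (pairE (pairE strE strE) natE) natE (fun t => t.2) := snd _ _
  have ku : CodeFP (pairE (pairE strE strE) natE) unE (fun t => min t.2 t.1.2.length) :=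
    unOfNatMin.comp ((strLength.comp u').pair k')
  have tk : CodeFP (pairE (pairE strE strE) natE) strE (fun t => t.1.2.take (min t.2 t.1.2.length)) :=
    strTake.comp (ku.pair u')
  have arg : CodeFP (pairE (pairE strE strE) natE) strE (fun t => boolPair t.1.1 (t.1.2.take (min t.2 t.1.2.length))) :=
    (y'.pair tk).recodeOut fun _ => rfl
  have pred : CodeFP (pairE (pairE strE strE) natE) bitE
      (fun t => S.Vb (boolPair t.1.1 (t.1.2.take (min t.2 t.1.2.length)))) := hV.comp arg
  have lst : CodeFP (pairE strE strE) (rawE natE) (fun q => List.range (q.2.length + 1)) :=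
    urange.comp (unSucc.comp (strLength.comp (snd _ _)))
  have tml : ∀ (l : List Bool) (i : ℕ), l.take (min i l.length) = l.take i := fun l i =>
    List.take_eq_take_iff.2 (by rw [Nat.min_assoc, Nat.min_self])
  exact ((any pred).comp ((CodeFP.id _).pair lst)).congr fun q => by simp only [tml]; rfl

/-- The certificate test of `H₁` is polynomial time. [cite: AroraBarak2009, §1.3] -/
theorem codeFP_chk₁ (hV : CodeFP strE bitE S.Vb) : CodeFP strE bitE S.chk₁ := by
  have F : CodeFP strE strE fstF := of_fn fstF fstF_mem_FP fun _ => rfl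
  have u : CodeFP strE strE sndF := of_fn sndF sndF_mem_FP fun _ => rfl
  have y : CodeFP strE strE (fun w => fstF (fstF w)) := F.comp F
  have z : CodeFP strE strE (fun w => sndF (fstF w)) := u.comp F
  have t1 : CodeFP strE bitE (fun w => decide ((sndF w).length = S.p.eval (fstF (fstF w)).length)) :=
    (CodeFP.eq unE_injective).comp ((strLength.comp u).pair ((codeFP_unPoly S.p).comp (strLength.comp y)))
  have t2 : CodeFP strE bitE (fun w => decide (sndF (fstF w) <+: sndF w)) := codeFP_isPrefix.comp (z.pair u)
  have t3 : CodeFP strE bitE (fun w => S.good₁ (fstF (fstF w)) (sndF w)) := (S.codeFP_good₁ hV).comp (y.pair u)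
  exact ((t1.and t2).and t3).congr fun _ => rfl

/-- **`H₁ ∈ NP`.** [cite: ChenEtAl2022, §5.2 (proof of Thm. 5)] -/
theorem H₁_mem_NP (hV : CodeFP strE bitE S.Vb) : S.H₁ ∈ Nondeterministic.NP := by
  refine memNP_of_codeFP S.p (S.codeFP_chk₁ hV) fun x => ⟨?_, ?_⟩
  · rintro ⟨u, hu, hzu, hg⟩
    refine ⟨u, ?_, ?_⟩
    · rw [hu]; exact TM2Iter.eval_mono _ (by have := length_fstF_sndF_le x; omega)
    · simp [chk₁, hu, hzu, hg]
  · rintro ⟨u, -, hc⟩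
    simp only [chk₁, fstF_boolPair, sndF_boolPair, Bool.and_eq_true, decide_eq_true_eq] at hc
    exact ⟨u, hc.1.1, hc.1.2, hc.2⟩

variable (R₁ : Red S.H₁ S.L)

/-- The common length `ℓ₁(n) = n + P₁(2n + p(n) + 3)` of the level-1 queries (`P₁` the output-length
polynomial of the reduction `r₁ : H₁ ≤ₚ L`): strictly increasing, `≥ n`, and at least the length of
every reduced query `r₁⟨y, z⟩` with `|y| = n`, `|z| ≤ p(n) + 1`. [cite: ChenEtAl2022, §5.1 (queries of length exactly ℓ(n) for a strictly increasing polynomial ℓ)] -/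
noncomputable def ℓ₁ : Polynomial ℕ :=
  X + R₁.P.comp (2 * X + S.p + 3)

/-- **The level-1 query** `g₁ y z = pad(r₁⟨y, z⟩, ℓ₁ |y|)`. [cite: ChenEtAl2022, §5.2 (proof of Thm. 5)] -/
noncomputable def g₁ (y z : List Bool) : List Bool :=
  S.pad (R₁.r (boolPair y z), (S.ℓ₁ R₁).eval y.length)

/-- The level-1 oracle bit: the refuted algorithm on the query. [cite: ChenEtAl2022, §5.2 (proof of Thm. 5)] -/
noncomputable def B₁ (y z : List Bool) : Bool :=
  S.A (S.g₁ R₁ y z)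

/-- The level-1 target length `p |y|`. [folklore] -/
def m₁ (y : List Bool) : ℕ :=
  S.p.eval y.length

/-- **The search fails on `y`**: the string found by the `A`-driven witness search is not good.
A polynomial-time property of `y`. [cite: ChenEtAl2022, §5.2 (proof of Thm. 5)] -/
noncomputable def searchFails (y : List Bool) : Bool :=
  !S.good₁ y (searchZ (S.B₁ R₁ y) (S.m₁ y))

/-- The reduced level-1 queries are shorter than `ℓ₁`. [folklore] -/
theorem length_r₁_le {y z : List Bool} (hz : z.length ≤ S.p.eval y.length + 1) :
    (R₁.r (boolPair y z)).length ≤ (S.ℓ₁ R₁).eval y.length := by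
  have h1 := R₁.length_le (boolPair y z)
  have h2 : (boolPair y z).length ≤ (2 * X + S.p + 3 : Polynomial ℕ).eval y.length := by
    rw [length_boolPair]; simp; omega
  have h3 := TM2Iter.eval_mono R₁.P h2
  rw [ℓ₁, eval_add, eval_X, eval_comp]
  omega

/-- Level-1 queries have length exactly `ℓ₁ |y|`. [cite: ChenEtAl2022, §5.1–5.2] -/
theorem length_g₁ (hS : S.Spec) {y z : List Bool} (hz : z.length ≤ S.p.eval y.length + 1) :
    (S.g₁ R₁ y z).length = (S.ℓ₁ R₁).eval y.length :=
  hS.pad_length _ _ (S.length_r₁_le R₁ hz)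

/-- **What a level-1 query asks**: `g₁ y z ∈ L ↔ ⟨y, z⟩ ∈ H₁`. [cite: ChenEtAl2022, §5.2 (proof of Thm. 5)] -/
theorem g₁_mem_iff (hS : S.Spec) {y z : List Bool} (hz : z.length ≤ S.p.eval y.length + 1) :
    S.g₁ R₁ y z ∈ S.L ↔ ∃ u : List Bool, u.length = S.p.eval y.length ∧ z <+: u ∧ S.good₁ y u = true := by
  rw [g₁, hS.pad_mem _ _ (S.length_r₁_le R₁ hz), ← R₁.reduces, boolPair_mem_H₁]

/-- The level-1 query map is polynomial time. [cite: AroraBarak2009, §1.3] -/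
theorem codeFP_g₁ (hC : S.Codes) : CodeFP (pairE strE strE) strE fun q => S.g₁ R₁ q.1 q.2 := by
  have hr : CodeFP (pairE strE strE) strE (fun q => R₁.r (boolPair q.1 q.2)) := ⟨R₁.r, R₁.mem_FP, fun _ => rfl⟩
  have hl : CodeFP (pairE strE strE) unE (fun q => (S.ℓ₁ R₁).eval q.1.length) :=
    (codeFP_unPoly _).comp (strLength.comp (fst _ _))
  exact (hC.pad.comp (hr.pair hl)).congr fun _ => rfl

/-- The level-1 oracle bit is polynomial time. [cite: AroraBarak2009, §1.3] -/
theorem codeFP_B₁ (hC : S.Codes) : CodeFP (pairE strE strE) bitE fun q => S.B₁ R₁ q.1 q.2 :=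
  (hC.A.comp (S.codeFP_g₁ R₁ hC)).congr fun _ => rfl

/-- The level-1 target length is polynomial time. [folklore] -/
theorem codeFP_m₁ : CodeFP strE unE S.m₁ := ((codeFP_unPoly S.p).comp strLength).congr fun _ => rfl

/-- **Failure of the search is polynomial time.** [cite: ChenEtAl2022, §5.2 (proof of Thm. 5, the condition can be checked in polynomial time)] -/
theorem codeFP_searchFails (hC : S.Codes) : CodeFP strE bitE (S.searchFails R₁) := by
  have hz : CodeFP strE strE (fun y => searchZ (S.B₁ R₁ y) (S.m₁ y)) := codeFP_searchZ (S.codeFP_B₁ R₁ hC) S.codeFP_m₁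
  exact (((S.codeFP_good₁ hC.Vb).comp ((CodeFP.id strE).pair hz)).not).congr fun _ => rfl

/-! ### Level 2: the bad-input search -/

/-- **The detectably bad inputs**: `A` accepts `y` but the `A`-driven witness search fails on `y`,
or `A` rejects `y` although `y ∈ L`. Every input on which `A` errs about `L` is detectably bad
(an accepted non-member has no witness to be found); conversely a detectably bad `y` on which `A`
is right exposes an error of `A` inside the witness search. [cite: ChenEtAl2022, §5.2 (proof of Thm. 5); GutfreundShaltielTashma2007] -/
def bad₂ : Language Bool :=
  {y | (S.A y = true ∧ S.searchFails R₁ y = true) ∨ (S.A y = false ∧ y ∈ S.L)}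

/-- An input on which `A` errs is detectably bad. [cite: ChenEtAl2022, §5.2 (proof of Thm. 5)] -/
theorem mem_bad₂_of_not_agree (hS : S.Spec) {y : List Bool} (h : ¬ (S.A y = true ↔ y ∈ S.L)) :
    y ∈ S.bad₂ R₁ := by
  cases hA : S.A y
  · right
    refine ⟨hA, ?_⟩
    by_contra hy
    exact h ⟨fun h' => by rw [hA] at h'; exact absurd h' Bool.false_ne_true, fun h' => absurd h' hy⟩
  · left
    refine ⟨hA, ?_⟩
    have hy : y ∉ S.L := fun hy => h ⟨fun _ => hy, fun _ => hA⟩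
    rw [searchFails, Bool.not_eq_true']
    by_contra hg
    rw [Bool.not_eq_false] at hg
    exact hy (S.mem_of_good₁ hS (by rw [length_searchZ]; rfl) hg)

/-- **The bad-prefix language** `H₂ = {⟨1ⁿ, x⟩ : some detectably bad y ∈ {0,1}ⁿ extends x}` (the
first component is read through its length only). [cite: ChenEtAl2022, §5.2 (proof of Thm. 5)] -/
def H₂ : Language Bool :=
  {w | ∃ y : List Bool, y.length = (fstF w).length ∧ sndF w <+: y ∧ y ∈ S.bad₂ R₁}

/-- Membership of a pair `⟨1ⁿ, x⟩` in `H₂`. [folklore] -/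
theorem boolPair_mem_H₂ (n : ℕ) (x : List Bool) :
    boolPair (unE n) x ∈ S.H₂ R₁ ↔ ∃ y : List Bool, y.length = n ∧ x <+: y ∧ y ∈ S.bad₂ R₁ := by
  change (∃ y : List Bool, y.length = (fstF (boolPair (unE n) x)).length ∧ sndF (boolPair (unE n) x) <+: y ∧
    y ∈ S.bad₂ R₁) ↔ _
  rw [fstF_boolPair, sndF_boolPair, length_unE]

/-- The certificate test of `H₂`: on `⟨⟨u, x⟩, ⟨y, v⟩⟩`, `|y| = |u|`, `x ⊑ y`, and either `A y ∧
searchFails y`, or `¬A y` and `v` is a good string of length `p |y|` for `y`. [folklore] -/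
noncomputable def chk₂ (w : List Bool) : Bool :=
  decide ((fstF (sndF w)).length = (fstF (fstF w)).length) && decide (sndF (fstF w) <+: fstF (sndF w)) &&
    (S.A (fstF (sndF w)) && S.searchFails R₁ (fstF (sndF w)) ||
      !S.A (fstF (sndF w)) && decide ((sndF (sndF w)).length = S.p.eval (fstF (sndF w)).length) &&
        S.good₁ (fstF (sndF w)) (sndF (sndF w)))

/-- The certificate test of `H₂` is polynomial time. [cite: AroraBarak2009, §1.3] -/
theorem codeFP_chk₂ (hC : S.Codes) : CodeFP strE bitE (S.chk₂ R₁) := by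
  have F : CodeFP strE strE fstF := of_fn fstF fstF_mem_FP fun _ => rfl
  have G : CodeFP strE strE sndF := of_fn sndF sndF_mem_FP fun _ => rfl
  have u : CodeFP strE strE (fun w => fstF (fstF w)) := F.comp F
  have x : CodeFP strE strE (fun w => sndF (fstF w)) := G.comp F
  have y : CodeFP strE strE (fun w => fstF (sndF w)) := F.comp G
  have v : CodeFP strE strE (fun w => sndF (sndF w)) := G.comp G
  have t1 : CodeFP strE bitE (fun w => decide ((fstF (sndF w)).length = (fstF (fstF w)).length)) :=
    (CodeFP.eq unE_injective).comp ((strLength.comp y).pair (strLength.comp u))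
  have t2 : CodeFP strE bitE (fun w => decide (sndF (fstF w) <+: fstF (sndF w))) := codeFP_isPrefix.comp (x.pair y)
  have a : CodeFP strE bitE (fun w => S.A (fstF (sndF w))) := hC.A.comp y
  have f : CodeFP strE bitE (fun w => S.searchFails R₁ (fstF (sndF w))) := (S.codeFP_searchFails R₁ hC).comp y
  have t3 : CodeFP strE bitE (fun w => decide ((sndF (sndF w)).length = S.p.eval (fstF (sndF w)).length)) :=
    (CodeFP.eq unE_injective).comp ((strLength.comp v).pair ((codeFP_unPoly S.p).comp (strLength.comp y)))
  have g : CodeFP strE bitE (fun w => S.good₁ (fstF (sndF w)) (sndF (sndF w))) := (S.codeFP_good₁ hC.Vb).comp (y.pair v)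
  exact ((t1.and t2).and ((a.and f).or ((a.not.and t3).and g))).congr fun _ => rfl

/-- **`H₂ ∈ NP`.** [cite: ChenEtAl2022, §5.2 (proof of Thm. 5)] -/
theorem H₂_mem_NP (hS : S.Spec) (hC : S.Codes) : S.H₂ R₁ ∈ Nondeterministic.NP := by
  refine memNP_of_codeFP (2 * X + 2 + S.p) (S.codeFP_chk₂ R₁ hC) fun w => ⟨?_, ?_⟩
  · rintro ⟨y, hy, hxy, hbad⟩
    have hyw : y.length ≤ w.length := by have := length_fstF_sndF_le w; omega
    rcases hbad with ⟨hA, hF⟩ | ⟨hA, hL⟩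
    · refine ⟨boolPair y [], ?_, ?_⟩
      · rw [length_boolPair]; simp; omega
      · simp [chk₂, hy, hxy, hA, hF]
    · obtain ⟨u, hu, hg⟩ := S.exists_good₁_of_mem hS hL
      refine ⟨boolPair y u, ?_, ?_⟩
      · rw [length_boolPair, hu]
        have := TM2Iter.eval_mono S.p hyw
        simp; omega
      · simp [chk₂, hy, hxy, hA, hu, hg]
  · rintro ⟨c, -, hc⟩
    simp only [chk₂, fstF_boolPair, sndF_boolPair, Bool.and_eq_true, Bool.or_eq_true, decide_eq_true_eq,
      Bool.not_eq_true'] at hc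
    obtain ⟨⟨hy, hxy⟩, hcase⟩ := hc
    refine ⟨fstF c, hy, hxy, ?_⟩
    rcases hcase with ⟨hA, hF⟩ | ⟨⟨hA, hu⟩, hg⟩
    · exact Or.inl ⟨hA, hF⟩
    · exact Or.inr ⟨hA, S.mem_of_good₁ hS hu.le hg⟩

variable (R₂ : Red (S.H₂ R₁) S.L)

/-- The common length `ℓ₂(n) = n + P₂(3n + 3)` of the level-2 queries. [cite: ChenEtAl2022, §5.1–5.2] -/
noncomputable def ℓ₂ : Polynomial ℕ :=
  X + R₂.P.comp (3 * X + 3)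

/-- **The level-2 query** `g₂ n x = pad(r₂⟨1ⁿ, x⟩, ℓ₂ n)`. [cite: ChenEtAl2022, §5.2 (proof of Thm. 5)] -/
noncomputable def g₂ (n : ℕ) (x : List Bool) : List Bool :=
  S.pad (R₂.r (boolPair (unE n) x), (S.ℓ₂ R₁ R₂).eval n)

/-- The level-2 oracle bit. [cite: ChenEtAl2022, §5.2 (proof of Thm. 5)] -/
noncomputable def B₂ (n : ℕ) (x : List Bool) : Bool :=
  S.A (S.g₂ R₁ R₂ n x)

/-- **The candidate bad input of length `n`** found by the level-2 search. [cite: ChenEtAl2022, §5.2 (proof of Thm. 5)] -/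
noncomputable def y₂ (n : ℕ) : List Bool :=
  searchZ (S.B₂ R₁ R₂ n) n

/-- The reduced level-2 queries are shorter than `ℓ₂`. [folklore] -/
theorem length_r₂_le {n : ℕ} {x : List Bool} (hx : x.length ≤ n + 1) :
    (R₂.r (boolPair (unE n) x)).length ≤ (S.ℓ₂ R₁ R₂).eval n := by
  have h1 := R₂.length_le (boolPair (unE n) x)
  have h2 : (boolPair (unE n) x).length ≤ (3 * X + 3 : Polynomial ℕ).eval n := by
    rw [length_boolPair, length_unE]; simp; omega
  have h3 := TM2Iter.eval_mono R₂.P h2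
  rw [ℓ₂, eval_add, eval_X, eval_comp]
  omega

/-- Level-2 queries have length exactly `ℓ₂ n`. [cite: ChenEtAl2022, §5.1–5.2] -/
theorem length_g₂ (hS : S.Spec) {n : ℕ} {x : List Bool} (hx : x.length ≤ n + 1) :
    (S.g₂ R₁ R₂ n x).length = (S.ℓ₂ R₁ R₂).eval n :=
  hS.pad_length _ _ (S.length_r₂_le R₁ R₂ hx)

/-- **What a level-2 query asks**: `g₂ n x ∈ L ↔ ⟨1ⁿ, x⟩ ∈ H₂`. [cite: ChenEtAl2022, §5.2 (proof of Thm. 5)] -/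
theorem g₂_mem_iff (hS : S.Spec) {n : ℕ} {x : List Bool} (hx : x.length ≤ n + 1) :
    S.g₂ R₁ R₂ n x ∈ S.L ↔ ∃ y : List Bool, y.length = n ∧ x <+: y ∧ y ∈ S.bad₂ R₁ := by
  rw [g₂, hS.pad_mem _ _ (S.length_r₂_le R₁ R₂ hx), ← R₂.reduces, boolPair_mem_H₂]

/-- The level-2 query map is polynomial time. [cite: AroraBarak2009, §1.3] -/
theorem codeFP_g₂ (hC : S.Codes) : CodeFP (pairE unE strE) strE fun q => S.g₂ R₁ R₂ q.1 q.2 := by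
  have hr : CodeFP (pairE unE strE) strE (fun q => R₂.r (boolPair (unE q.1) q.2)) := ⟨R₂.r, R₂.mem_FP, fun _ => rfl⟩
  have hl : CodeFP (pairE unE strE) unE (fun q => (S.ℓ₂ R₁ R₂).eval q.1) := (codeFP_unPoly _).comp (fst _ _)
  exact (hC.pad.comp (hr.pair hl)).congr fun _ => rfl

/-- The level-2 oracle bit is polynomial time. [cite: AroraBarak2009, §1.3] -/
theorem codeFP_B₂ (hC : S.Codes) : CodeFP (pairE unE strE) bitE fun q => S.B₂ R₁ R₂ q.1 q.2 :=
  (hC.A.comp (S.codeFP_g₂ R₁ R₂ hC)).congr fun _ => rfl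

/-- The candidate bad input is polynomial time in `1ⁿ`. [cite: ChenEtAl2022, §5.2 (proof of Thm. 5)] -/
theorem codeFP_y₂ (hC : S.Codes) : CodeFP unE strE (S.y₂ R₁ R₂) :=
  (codeFP_searchZ (S.codeFP_B₂ R₁ R₂ hC) (CodeFP.id unE)).congr fun _ => rfl

/-! ### The constant-size list-refuter and its correctness -/

/-- **The list printed on `1ⁿ`** (a constant-size list-refuter, Def. 4): the five level-2 queries,
the candidate bad input `y` of length `n`, and the five level-1 queries at `y`.
[cite: ChenEtAl2022, Def. 4 and §5.2 (proof of Thm. 5)] -/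
noncomputable def slots (n : ℕ) : List (List Bool) :=
  (probes (S.B₂ R₁ R₂ n) n).map (S.g₂ R₁ R₂ n) ++ [S.y₂ R₁ R₂ n] ++
    (probes (S.B₁ R₁ (S.y₂ R₁ R₂ n)) (S.m₁ (S.y₂ R₁ R₂ n))).map (S.g₁ R₁ (S.y₂ R₁ R₂ n))

/-- **Correctness of the list-refuter.** If `A` errs about `L` on some input of length `n`, then it
errs on one of the eleven strings printed on `1ⁿ`. (If `A` were right on all of them: the level-2
oracle bit agrees with `H₂` on the probes and the root `⟨1ⁿ, ε⟩ ∈ H₂`, so the found `y` is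
detectably bad; `A` is right on `y`, so `A y = 1`, `y ∈ L` and the witness search fails on `y`; but
the level-1 oracle bit agrees with `H₁` on its probes and `⟨y, ε⟩ ∈ H₁`, so the witness search
succeeds.) [cite: ChenEtAl2022, §5.2 (proof of Thm. 5); GutfreundShaltielTashma2007] -/
theorem exists_mem_slots_not_agree (hS : S.Spec) {n : ℕ}
    (hbad : ∃ y : List Bool, y.length = n ∧ ¬ (S.A y = true ↔ y ∈ S.L)) :
    ∃ x ∈ S.slots R₁ R₂ n, ¬ (S.A x = true ↔ x ∈ S.L) := by
  by_contra hall
  push Not at hall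
  have hagree : ∀ x ∈ S.slots R₁ R₂ n, (S.A x = true ↔ x ∈ S.L) := hall
  -- level 2
  set B := S.B₂ R₁ R₂ n with hB
  have h2 : ∀ z ∈ probes B n, (B z = true ↔ ∃ y : List Bool, y.length = n ∧ z <+: y ∧ y ∈ S.bad₂ R₁) := by
    intro z hz
    have hx : S.g₂ R₁ R₂ n z ∈ S.slots R₁ R₂ n := by
      simp only [slots, List.mem_append, List.mem_map]
      exact Or.inl (Or.inl ⟨z, hz, rfl⟩)
    rw [← S.g₂_mem_iff R₁ R₂ hS (length_le_of_mem_probes B hz)]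
    exact hagree _ hx
  have hroot : ∃ y : List Bool, y.length = n ∧ [] <+: y ∧ y ∈ S.bad₂ R₁ := by
    obtain ⟨y, hy, hyA⟩ := hbad
    exact ⟨y, hy, List.nil_prefix, S.mem_bad₂_of_not_agree R₁ hS hyA⟩
  have hQ : ∀ z : List Bool, (∃ y : List Bool, y.length = n ∧ z <+: y ∧ y ∈ S.bad₂ R₁) → z.length < n →
      (∃ y : List Bool, y.length = n ∧ z ++ [false] <+: y ∧ y ∈ S.bad₂ R₁) ∨
        (∃ y : List Bool, y.length = n ∧ z ++ [true] <+: y ∧ y ∈ S.bad₂ R₁) := by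
    rintro z ⟨y, hy, hzy, hyb⟩ hlt
    obtain ⟨b, hb⟩ := prefix_append_bit_of_lt hzy (by omega)
    cases b
    · exact Or.inl ⟨y, hy, hb, hyb⟩
    · exact Or.inr ⟨y, hy, hb, hyb⟩
  obtain ⟨y, hy, hzy, hyb⟩ := searchZ_sound B hQ h2 hroot
  have hyz : y = S.y₂ R₁ R₂ n := by
    have h := List.prefix_iff_eq_take.1 hzy
    rw [length_searchZ, List.take_of_length_le (by omega)] at h
    exact h.symm
  subst hyz
  -- `A` is right on `y`
  have hAy : S.A (S.y₂ R₁ R₂ n) = true ↔ S.y₂ R₁ R₂ n ∈ S.L := by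
    apply hagree
    simp [slots]
  rcases hyb with ⟨hA, hF⟩ | ⟨hA, hL⟩
  swap
  · rw [hA] at hAy; exact absurd (hAy.2 hL) Bool.false_ne_true
  have hL : S.y₂ R₁ R₂ n ∈ S.L := hAy.1 hA
  -- level 1
  set y := S.y₂ R₁ R₂ n with hydef
  set B' := S.B₁ R₁ y with hB'
  have h1 : ∀ z ∈ probes B' (S.m₁ y),
      (B' z = true ↔ ∃ u : List Bool, u.length = S.p.eval y.length ∧ z <+: u ∧ S.good₁ y u = true) := by
    intro z hz
    have hx : S.g₁ R₁ y z ∈ S.slots R₁ R₂ n := by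
      simp only [slots, List.mem_append, List.mem_map]
      exact Or.inr ⟨z, hz, rfl⟩
    rw [← S.g₁_mem_iff R₁ hS (length_le_of_mem_probes B' hz)]
    exact hagree _ hx
  have hroot1 : ∃ u : List Bool, u.length = S.p.eval y.length ∧ [] <+: u ∧ S.good₁ y u = true := by
    obtain ⟨u, hu, hg⟩ := S.exists_good₁_of_mem hS hL
    exact ⟨u, hu, List.nil_prefix, hg⟩
  have hQ1 : ∀ z : List Bool, (∃ u : List Bool, u.length = S.p.eval y.length ∧ z <+: u ∧ S.good₁ y u = true) →
      z.length < S.m₁ y →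
      (∃ u : List Bool, u.length = S.p.eval y.length ∧ z ++ [false] <+: u ∧ S.good₁ y u = true) ∨
        (∃ u : List Bool, u.length = S.p.eval y.length ∧ z ++ [true] <+: u ∧ S.good₁ y u = true) := by
    rintro z ⟨u, hu, hzu, hug⟩ hlt
    obtain ⟨b, hb⟩ := prefix_append_bit_of_lt hzu (by rw [hu]; exact hlt)
    cases b
    · exact Or.inl ⟨u, hu, hb, hug⟩
    · exact Or.inr ⟨u, hu, hb, hug⟩
  obtain ⟨u, hu, hzu, hug⟩ := searchZ_sound B' hQ1 h1 hroot1
  have huz : u = searchZ B' (S.m₁ y) := by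
    have h := List.prefix_iff_eq_take.1 hzu
    rw [length_searchZ, List.take_of_length_le (by rw [m₁]; omega)] at h
    exact h.symm
  subst huz
  have : S.searchFails R₁ y = false := by rw [searchFails, hug]; rfl
  rw [this] at hF
  exact Bool.false_ne_true hF

/-! ### The eleven slots: position, length and polynomial time -/

/-- The `j`-th printed string. [cite: ChenEtAl2022, Lemma 6 (proof, the algorithm printing the i-th string)] -/
noncomputable def slotFn (j n : ℕ) : List Bool :=
  (S.slots R₁ R₂ n).getD j []

/-- The length function of the `j`-th slot: `ℓ₂` for the level-2 queries, the identity for the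
candidate bad input, `ℓ₁` for the level-1 queries. [cite: ChenEtAl2022, Def. 4 (the i-th string has length ℓ^(i)(n) ≥ n)] -/
noncomputable def slotLen (j n : ℕ) : ℕ :=
  if j < 5 then (S.ℓ₂ R₁ R₂).eval n else if j = 5 then n else (S.ℓ₁ R₁).eval n

/-- There are eleven slots. [folklore] -/
theorem length_slots (n : ℕ) : (S.slots R₁ R₂ n).length = 11 := by
  simp [slots, probes]

/-- Level-2 query slots have length `ℓ₂ n`. [folklore] -/
theorem length_of_mem_map_g₂ (hS : S.Spec) {n : ℕ} {x : List Bool}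
    (hx : x ∈ (probes (S.B₂ R₁ R₂ n) n).map (S.g₂ R₁ R₂ n)) : x.length = (S.ℓ₂ R₁ R₂).eval n := by
  obtain ⟨z, hz, rfl⟩ := List.mem_map.1 hx
  exact S.length_g₂ R₁ R₂ hS (length_le_of_mem_probes _ hz)

/-- Level-1 query slots have length `ℓ₁ n`. [folklore] -/
theorem length_of_mem_map_g₁ (hS : S.Spec) {n : ℕ} {x : List Bool}
    (hx : x ∈ (probes (S.B₁ R₁ (S.y₂ R₁ R₂ n)) (S.m₁ (S.y₂ R₁ R₂ n))).map (S.g₁ R₁ (S.y₂ R₁ R₂ n))) :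
    x.length = (S.ℓ₁ R₁).eval n := by
  obtain ⟨z, hz, rfl⟩ := List.mem_map.1 hx
  rw [S.length_g₁ R₁ hS (length_le_of_mem_probes _ hz), y₂, length_searchZ]

/-- **Each slot has its prescribed length.** [cite: ChenEtAl2022, Def. 4] -/
theorem length_slotFn (hS : S.Spec) {j : ℕ} (hj : j < 11) (n : ℕ) :
    (S.slotFn R₁ R₂ j n).length = S.slotLen R₁ R₂ j n := by
  have hA : ((probes (S.B₂ R₁ R₂ n) n).map (S.g₂ R₁ R₂ n)).length = 5 := by simp [probes]
  have hB : ((probes (S.B₁ R₁ (S.y₂ R₁ R₂ n)) (S.m₁ (S.y₂ R₁ R₂ n))).map (S.g₁ R₁ (S.y₂ R₁ R₂ n))).length = 5 := by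
    simp [probes]
  unfold slotFn slots slotLen
  by_cases h5 : j < 5
  · rw [if_pos h5, List.getD_append _ _ _ _ (by simp [hA]; omega), List.getD_append _ _ _ _ (by omega),
      List.getD_eq_getElem _ _ (by omega)]
    exact S.length_of_mem_map_g₂ R₁ R₂ hS (List.getElem_mem _)
  rw [if_neg h5]
  by_cases h5' : j = 5
  · subst h5'
    rw [if_pos rfl, List.getD_append _ _ _ _ (by simp [hA]), List.getD_append_right _ _ _ _ (by omega), hA]
    simp [y₂]
  · rw [if_neg h5', List.getD_append_right _ _ _ _ (by simp [hA]; omega), List.length_append, hA,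
      List.length_singleton, List.getD_eq_getElem _ _ (by rw [hB]; omega)]
    exact S.length_of_mem_map_g₁ R₁ R₂ hS (List.getElem_mem _)

/-- Each length function is strictly increasing. [cite: ChenEtAl2022, Def. 4] -/
theorem strictMono_slotLen (j : ℕ) : StrictMono (S.slotLen R₁ R₂ j) := by
  intro a b hab
  unfold slotLen
  by_cases h5 : j < 5
  · rw [if_pos h5, if_pos h5]; exact strictMono_eval_X_add _ hab
  rw [if_neg h5, if_neg h5]
  by_cases h5' : j = 5
  · rw [if_pos h5', if_pos h5']; exact hab
  · rw [if_neg h5', if_neg h5']; exact strictMono_eval_X_add _ hab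

/-- Each length function dominates the identity. [cite: ChenEtAl2022, Def. 4] -/
theorem le_slotLen (j n : ℕ) : n ≤ S.slotLen R₁ R₂ j n := by
  unfold slotLen
  split_ifs
  · exact le_eval_X_add _ _
  · exact le_rfl
  · exact le_eval_X_add _ _

/-- **The printed list is polynomial time in `1ⁿ`.** [cite: ChenEtAl2022, §5.2 (proof of Thm. 5)] -/
theorem codeFP_slots (hC : S.Codes) : CodeFP unE (rawE strE) (S.slots R₁ R₂) := by
  have hB₂ := S.codeFP_B₂ R₁ R₂ hC
  have hy := S.codeFP_y₂ R₁ R₂ hC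
  -- level 2
  have hP2 : CodeFP unE (rawE strE) (fun n => probes (S.B₂ R₁ R₂ n) n) := codeFP_probes hB₂ (CodeFP.id unE)
  have hA : CodeFP unE (rawE strE) (fun n => (probes (S.B₂ R₁ R₂ n) n).map (S.g₂ R₁ R₂ n)) :=
    ((map (S.codeFP_g₂ R₁ R₂ hC)).comp ((CodeFP.id unE).pair hP2)).congr fun _ => rfl
  -- level 1 at `y`
  have hB₁ : CodeFP (pairE strE strE) bitE (fun q => S.B₁ R₁ q.1 q.2) := S.codeFP_B₁ R₁ hC
  have hP1 : CodeFP strE (rawE strE) (fun y => probes (S.B₁ R₁ y) (S.m₁ y)) := codeFP_probes hB₁ S.codeFP_m₁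
  have hM1 : CodeFP strE (rawE strE) (fun y => (probes (S.B₁ R₁ y) (S.m₁ y)).map (S.g₁ R₁ y)) :=
    ((map (S.codeFP_g₁ R₁ hC)).comp ((CodeFP.id strE).pair hP1)).congr fun _ => rfl
  have hBpart := hM1.comp hy
  have hmid : CodeFP unE (rawE strE) (fun n => [S.y₂ R₁ R₂ n]) := (rawSingleton strE).comp hy
  exact ((rawAppend strE).comp (((rawAppend strE).comp (hA.pair hmid)).pair hBpart)).congr fun _ => rfl

/-- Each slot is polynomial time in `1ⁿ`. [cite: ChenEtAl2022, Lemma 6 (proof)] -/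
theorem codeFP_slotFn (hC : S.Codes) (j : ℕ) : CodeFP unE strE (S.slotFn R₁ R₂ j) :=
  ((rawGetD strE (d := ([] : List Bool)) rfl).comp ((S.codeFP_slots R₁ R₂ hC).pair (const unE j))).congr
    fun _ => rfl

/-- **Correctness, by position.** If `A` errs on some input of length `n` then it errs on some slot.
[cite: ChenEtAl2022, §5.2 (proof of Thm. 5)] -/
theorem exists_slotFn_not_agree (hS : S.Spec) {n : ℕ}
    (hbad : ∃ y : List Bool, y.length = n ∧ ¬ (S.A y = true ↔ y ∈ S.L)) :
    ∃ j, j < 11 ∧ ¬ (S.A (S.slotFn R₁ R₂ j n) = true ↔ S.slotFn R₁ R₂ j n ∈ S.L) := by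
  obtain ⟨x, hx, hxA⟩ := S.exists_mem_slots_not_agree R₁ R₂ hS hbad
  obtain ⟨j, hj, rfl⟩ := List.mem_iff_getElem.1 hx
  refine ⟨j, by rw [length_slots] at hj; exact hj, ?_⟩
  rwa [slotFn, List.getD_eq_getElem _ _ hj]

end Setting

/-! ### Errors at infinitely many lengths; pigeonhole over the slots -/

/-- **A language decided by a polynomial-time bit up to finitely many lengths is in `P`** (patch
the short inputs by a finite table). Contrapositive form used below: if `L ∉ P` then every
polynomial-time `A` errs about `L` at infinitely many input lengths.
[cite: ChenEtAl2022, §5.1 (proof of Thm. 4, infinitely many bad input lengths)] -/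
theorem frequently_exists_not_agree {L : Language Bool} {A : List Bool → Bool} (hL : L ∉ Classes.P)
    (hA : CodeFP strE bitE A) :
    ∃ᶠ n in atTop, ∃ y : List Bool, y.length = n ∧ ¬ (A y = true ↔ y ∈ L) := by
  classical
  by_contra hnot
  rw [Filter.not_frequently, Filter.eventually_atTop] at hnot
  obtain ⟨N, hN⟩ := hnot
  push Not at hN
  -- the finite table of short members
  have hfin : ({x : List Bool | x.length < N ∧ x ∈ L} : Set (List Bool)).Finite :=
    (List.finite_length_lt Bool N).subset fun x hx => hx.1
  set T : List (List Bool) := hfin.toFinset.toList with hT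
  have hTmem : ∀ x : List Bool, x ∈ T ↔ x.length < N ∧ x ∈ L := fun x => by
    rw [hT, Finset.mem_toList, Set.Finite.mem_toFinset]; rfl
  -- the patched decider
  set D : List Bool → Bool := fun x => if decide (N ≤ x.length) then A x else decide (x ∈ T) with hD
  have hDc : CodeFP strE bitE D := by
    have ht : CodeFP strE bitE (fun x => decide (N ≤ x.length)) := natLeUn.comp ((const strE N).pair strLength)
    have hm : CodeFP strE bitE (fun x => decide (x ∈ T)) :=
      (mem (eα := strE) Function.injective_id).comp ((CodeFP.id strE).pair (const strE T))
    exact (ht.ite hA hm).congr fun _ => rfl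
  have hDL : ∀ x, D x = true ↔ x ∈ L := by
    intro x
    by_cases hx : N ≤ x.length
    · simp only [hD, hx, decide_true, if_true]
      exact hN x.length hx x rfl
    · simp only [hD, hx, decide_false, Bool.false_eq_true, if_false]
      rw [decide_eq_true_iff, hTmem]
      exact ⟨fun h => h.2, fun h => ⟨not_le.mp hx, h⟩⟩
  have hP := memP_of_codeFP hDc
  have hLe : L = {w | D w = true} := Set.ext fun x => (hDL x).symm
  exact hL (hLe ▸ hP)

/-- Pigeonhole for `∃ᶠ` over finitely many indices. [folklore] -/
theorem exists_frequently_of_frequently_exists_lt {E : ℕ → ℕ → Prop} :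
    ∀ {k : ℕ}, (∃ᶠ n in atTop, ∃ j, j < k ∧ E j n) → ∃ j, j < k ∧ ∃ᶠ n in atTop, E j n
  | 0, h => absurd (h.mono fun n ⟨j, hj, _⟩ => (Nat.not_lt_zero j hj).elim) (Filter.frequently_false _)
  | k + 1, h => by
    have h' : ∃ᶠ n in atTop, E k n ∨ ∃ j, j < k ∧ E j n :=
      h.mono fun n ⟨j, hj, hE⟩ => by
        rcases Nat.lt_succ_iff_lt_or_eq.1 hj with hlt | rfl
        · exact Or.inr ⟨j, hlt, hE⟩
        · exact Or.inl hE
    rcases Filter.frequently_or_distrib.1 h' with h₁ | h₂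
    · exact ⟨k, Nat.lt_succ_self k, h₁⟩
    · obtain ⟨j, hj, hjE⟩ := exists_frequently_of_frequently_exists_lt h₂
      exact ⟨j, Nat.lt_succ_of_lt hj, hjE⟩

/-! ### Lemma 6: one slot of a constant-size list-refuter is a refuter -/

/-- The inverse of the length function of a slot `f`, read off `f` itself: the first `n ≤ m` with
`|f n| = m` (`m + 1` if there is none). [cite: ChenEtAl2022, Lemma 6 (proof, ℓ^(i) is strictly increasing hence injective)] -/
def lenInv (f : ℕ → List Bool) (m : ℕ) : ℕ :=
  (List.range (m + 1)).findIdx fun n => decide ((f (min n m)).length = m)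

/-- **The refuter of a slot** (`B^{(i)}` of Lemma 6): on `1ᵐ`, print the slot string of the stage `n`
whose length is `m`. [cite: ChenEtAl2022, Lemma 6] -/
def slotRefuter (f : ℕ → List Bool) (m : ℕ) : List Bool :=
  f (min (lenInv f m) m)

/-- `lenInv` inverts an increasing length function dominating the identity. [cite: ChenEtAl2022, Lemma 6 (proof)] -/
theorem lenInv_length {f : ℕ → List Bool} (hmono : StrictMono fun n => (f n).length) (hle : ∀ n, n ≤ (f n).length)
    (n : ℕ) : lenInv f (f n).length = n := by
  set m := (f n).length with hm
  have hn : n < (List.range (m + 1)).length := by rw [List.length_range]; exact Nat.lt_succ_of_le (hle n)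
  rw [lenInv, List.findIdx_eq hn]
  refine ⟨by simp [min_eq_left (hle n), hm], fun j hj => ?_⟩
  have hjm : j ≤ m := (hj.le.trans (hle n))
  simp only [List.getElem_range, min_eq_left hjm, decide_eq_false_iff_not]
  exact fun h => absurd (hmono.injective h) (Nat.ne_of_lt hj)

/-- The refuter of a slot prints the slot string on its own length. [cite: ChenEtAl2022, Lemma 6 (proof)] -/
theorem slotRefuter_length {f : ℕ → List Bool} (hmono : StrictMono fun n => (f n).length)
    (hle : ∀ n, n ≤ (f n).length) (n : ℕ) : slotRefuter f (f n).length = f n := by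
  rw [slotRefuter, lenInv_length hmono hle, min_eq_left (hle n)]

/-- **The refuter of a polynomial-time slot is polynomial time** (`poly(n) ≤ poly(ℓ(n))`; the stage
is found by a search over `n ≤ m`). [cite: ChenEtAl2022, Lemma 6 (proof)] -/
theorem codeFP_slotRefuter {f : ℕ → List Bool} (hf : CodeFP unE strE f) : CodeFP unE strE (slotRefuter f) := by
  have hlist : CodeFP unE (rawE natE) (fun m => List.range (m + 1)) := urange.comp unSucc
  have hmin : CodeFP (pairE unE natE) unE (fun q => min q.2 q.1) := unOfNatMin
  have hpred : CodeFP (pairE unE natE) bitE (fun q => decide ((f (min q.2 q.1)).length = q.1)) :=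
    (CodeFP.eq unE_injective).comp ((strLength.comp (hf.comp hmin)).pair (fst _ _))
  have hinv : CodeFP unE natE (lenInv f) := ((findIdxFP hpred).comp ((CodeFP.id unE).pair hlist)).congr fun _ => rfl
  exact (hf.comp (unOfNatMin.comp ((CodeFP.id unE).pair hinv))).congr fun _ => rfl

/-- **Lemma 6 (constant-size list-refuter ⟹ refuter), one slot.** A polynomial-time slot whose
length function is strictly increasing and `≥ n`, and which is a counterexample for infinitely many
`n`, yields a `P`-refuter. [cite: ChenEtAl2022, Lemma 6] -/
theorem isPRefuter_slotRefuter {L L'' : Language Bool} {f : ℕ → List Bool} (hf : CodeFP unE strE f)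
    (hmono : StrictMono fun n => (f n).length) (hle : ∀ n, n ≤ (f n).length)
    (hio : ∃ᶠ n in atTop, (f n ∈ L ↔ f n ∉ L'')) : IsPRefuter L L'' (slotRefuter f) := by
  refine ⟨(codeFP_slotRefuter hf).polyTimeComputable, ?_⟩
  have h : ∃ᶠ n in atTop, (slotRefuter f (f n).length).length = (f n).length ∧
      (slotRefuter f (f n).length ∈ L ↔ slotRefuter f (f n).length ∉ L'') :=
    hio.mono fun n hn => by rw [slotRefuter_length hmono hle]; exact ⟨rfl, hn⟩
  exact hmono.tendsto_atTop.frequently h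

end GSTRefuter

/-! ### Theorem 1.2, `(𝒞, 𝒟) = (P, NP)` -/

open GSTRefuter in
/-- **Discharge of `pConstructiveSeparation_of_not_NP_subset_P`** (Chen–Jin–Santhanam–Williams,
Thm. 1.2 with `(𝒞, 𝒟) = (P, NP)`, the Gutfreund–Shaltiel–Ta-Shma theorem): if `NP ⊄ P` then every
paddable `NP`-complete `L` has, against every `L'' ∈ P`, a `P`-refuter. Proof: the eleven-slot
list-refuter `Setting.slots` is correct at every length where the algorithm errs
(`Setting.exists_slotFn_not_agree`), there are infinitely many such lengths
(`frequently_exists_not_agree`, as `L ∉ P`), some slot is hit infinitely often (pigeonhole), and that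
slot is a refuter (`isPRefuter_slotRefuter`, Lemma 6). [cite: ChenEtAl2022, Thm. 1.2 and §5.2 (Thm. 5, Lemma 6)] -/
theorem pConstructiveSeparation_of_not_NP_subset_P_holds : pConstructiveSeparation_of_not_NP_subset_P := by
  intro hNP L hL hpad L'' hL''
  classical
  have hLP : L ∉ Classes.P := fun h => hNP (NP_subset_P_of_isNPComplete_of_mem_P hL h)
  obtain ⟨V, hVP, p, hV⟩ := mem_NP_iff_verifier.1 hL.mem
  obtain ⟨pad, hpadC, hpadS⟩ := hpad
  -- the data
  set S : Setting := ⟨L, pad, fun x => L''.boolIndicator x, fun x => V.boolIndicator x, p⟩ with hSdef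
  have hS : S.Spec :=
    { pad_length := fun x m h => (hpadS x m h).1
      pad_mem := fun x m h => (hpadS x m h).2
      ver := fun x => (hV x).trans <| by
        simp only [hSdef]
        exact exists_congr fun w => and_congr Iff.rfl (Set.mem_iff_boolIndicator _ _) }
  have hC : S.Codes := ⟨codeFP_pad hpadC, of_fn _ (indicatorFn_mem_FP hL'') fun _ => rfl,
    of_fn _ (indicatorFn_mem_FP hVP) fun _ => rfl⟩
  -- the reductions
  obtain ⟨R₁⟩ := Red.nonempty_of_karpReducible (hL.isHard _ (S.H₁_mem_NP hC.Vb))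
  obtain ⟨R₂⟩ := Red.nonempty_of_karpReducible (hL.isHard _ (S.H₂_mem_NP R₁ hS hC))
  -- infinitely many bad lengths, each hitting a slot
  have hA : ∀ x : List Bool, (S.A x = true ↔ x ∈ S.L) ↔ (x ∈ L'' ↔ x ∈ L) := fun x =>
    iff_congr (Set.mem_iff_boolIndicator L'' x).symm Iff.rfl
  have hfreq : ∃ᶠ n in atTop, ∃ j, j < 11 ∧
      ¬ (S.A (S.slotFn R₁ R₂ j n) = true ↔ S.slotFn R₁ R₂ j n ∈ S.L) :=
    (frequently_exists_not_agree (A := S.A) hLP hC.A).mono fun n hn => S.exists_slotFn_not_agree R₁ R₂ hS hn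
  obtain ⟨j, hj, hjo⟩ := exists_frequently_of_frequently_exists_lt hfreq
  refine ⟨slotRefuter (S.slotFn R₁ R₂ j), isPRefuter_slotRefuter (S.codeFP_slotFn R₁ R₂ hC j) ?_ ?_ ?_⟩
  · intro a b hab
    simp only [S.length_slotFn R₁ R₂ hS hj]
    exact S.strictMono_slotLen R₁ R₂ j hab
  · intro n
    rw [S.length_slotFn R₁ R₂ hS hj]
    exact S.le_slotLen R₁ R₂ j n
  · refine hjo.mono fun n hn => ?_
    rw [hA] at hn
    tauto

end Literature.Computability.MetaComplexity
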